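import Summits.QuantumFields.BalabanUV.Beta.GAN24.DerivativeRateTransferAccretiveBound

/-!
# `BalabanUV.Beta.GAN24.DerivativeRateTransferStraighten` — binder row G-an2-4 ∕ (CONV-C), route R6 «VALUES, NOT DERIVATIVES», PART 38:
# «ACCRETIVE S2», THE Q-JET HALF AS AN EXACT REDUCTION — constraint straightening is a congruence of the bordered letters (any field), every
# complex-symmetric fine form splits as `(Re M)^ + i•(Im M)^`, hence S2 for a family WITH constraint jets `Q̂ + z₁Q̂₁ + z₂Q̂₂` at a point `z`
# ⇐ the straightening factor `W(z) = 1 + z₁ℋQ₁ + z₂ℋQ₂` is invertible ∧ the accretive REAL letters of the straightened form `W(z)⁻ᵀĤ(z)W(z)⁻¹`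
# (unit b2b-balaban-gan24-p3, gen 39; §1 = gan24-idea-1 g45's scratch `StraighteningSketch` 95225f12a41a36d3 re-typed with credit, Q-45-1′ (i))

NOT IN PRINT; OUR PROOF (for the ROUTE; [folklore] block algebra over a field — an2's `kkt ∕ effForm ∕ minOp` and `kktInv_eq_fromBlocks` BY NAME — plus
PART 35 (D) ∕ PART 36 (A′) BY NAME).  HONEST FRAMING (cell contract, verbatim): «discharging `BetaPertH` makes Bałaban's UV stability UNCONDITIONAL — a real
constructive-QFT result; it is NOT the continuum limit and NOT the Clay problem.»  HONEST DEPENDENCY (verbatim): «continuum YM on T⁴ ⇐ BetaPertH ∧ nine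
spine estimates (0/9 proved); BetaPertH ⇐ (D1) ∧ (D4) ∧ CAP+tail; G-an2-4 gates asym, D1 and NE2/3/4.»

WHY THIS FILE.  PARTs 35–37 discharge PART 32 END's S2 on the AXIAL SLICE (`Q₁ = Q₂ = 0`).  an1's instances carry Q-jets ([B9] p. 417 (3.110): the
averaging depends on the background), and with a COMPLEX constraint map the accretive kernel argument fails (no conjugation symmetry; gan24-idea-1 g45's
toy t45 sees near-singular dips at `|Im z| ≈ 1∕‖Q⁺Q₁‖`).  What survives EXACTLY: (§1) over any field, `kkt(VᵀHV, QV) = diag(Vᵀ,1)·kkt(H,Q)·diag(V,1)`,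
so `𝒮(VᵀHV, QV) = 𝒮(H,Q)`, `ℋ(VᵀHV, QV) = V⁻¹ℋ(H,Q)`, and with ANY right inverse `R` of `Q` (the real-point minimiser `ℋ = minOp H₀ Q` is one:
`Qℋ = 1`) the jet family factors `Q + z₁Q₁ + z₂Q₂ = Q·W`, `W = 1 + z₁RQ₁ + z₂RQ₂`; for invertible `W`, `𝒮(H, Q·W) = 𝒮(W⁻ᵀHW⁻¹, Q)` and
`kkt(H, Q·W)` is nonsingular IFF `kkt(W⁻ᵀHW⁻¹, Q)` is; (§2) every complex matrix is `(Re M)^ + i•(Im M)^` with `Re M`, `Im M` REAL, symmetric when `M`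
is — so PART 35 (D) and PART 36 (A′) apply to the straightened form VERBATIM; (§3) the reduction stated at a point: S2 at `z` ⇐ `W(z)` invertible +
the accretive real letters (PSD, real nonsingularity, sector, row bound) of `Re ∕ Im (W(z)⁻ᵀĤ(z)W(z)⁻¹)`.  The PERTURBATIVE content that remains —
«inside `|z|·sup_k‖ℋ_kQ_iₖ‖ < ½` the factor is invertible and the straightened real part keeps PSD + sector» — is the instance letter `n_Q`
(gan24-idea-1 g45 Q-45-1′ (iii); an1 g73 W-5: NOT a product of rows an1 holds), displayed, not supplied.

WHAT THIS FILE PROVES (0 sorry, 0 `def`, nothing cited):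
* §1 [folklore; gan24-idea-1 g45 `StraighteningSketch` re-typed] `kkt_congr`, `det_kkt_congr`, `isUnit_det_kkt_congr_iff`, `kktInv_congr`, **`effForm_congr`**,
  `minOp_congr`, `straighten₂_of_rightInverse`, **`straighten₂_by_minOp`**, **`effForm_straighten`**, **`isUnit_det_kkt_straighten_iff`**.
* §2 [folklore] `eq_map_re_add_map_im` (`M = (Re M)^ + i•(Im M)^`), `transpose_map_re` ∕ `transpose_map_im`, **`isUnit_det_kkt_of_re_im`** (PART 35 (D) for a
  general complex-symmetric fine form), **`norm_effForm_apply_le_of_re_im`** (PART 36 (A′) likewise).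
* §3 **`isUnit_det_kkt_jets_of_straighten`**, **`norm_effForm_jets_le_of_straighten`** — S2's two letters for `(Ĥ(z), Q̂·W)` at one point from `W`
  invertible + the accretive real letters of the straightened form.
WHAT IT DOES NOT DO: bound the straightening radius or the straightened letters for any of Bałaban's operators (the instance letter `n_Q`); S2(ii).
SUPPLIER work on route R6 (rank 2, REDUCTION, no seat); no consumer of record; NEVER «G-an2-4 closed»; NOT (CONV-C), NOT D1, NOT `BetaPertH`, NOT continuum,
NOT Clay.  Records: `HOME/b2b-balaban-gan24-p3/WOODBURY-FIBRE.md` v13.9.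
-/

noncomputable section

open Matrix
open scoped ComplexOrder

namespace Summit.QuantumFields.BalabanUV.Beta.GAN24.DerivativeRateTransferStraighten

open Literature.MathematicalPhysics.QuantumFieldTheory.Balaban1983to89.Beta.Composition (kkt)
open Literature.MathematicalPhysics.QuantumFieldTheory.Balaban1983to89.Beta.CompositionSingular (effForm minOp mul_minOp kkt_eq_fromBlocks
  kktInv_eq_fromBlocks)
open Summit.QuantumFields.BalabanUV.Beta.GAN24.DerivativeRateTransferAccretive (isUnit_det_kkt_accretive)
open Summit.QuantumFields.BalabanUV.Beta.GAN24.DerivativeRateTransferAccretiveBound (norm_effForm_accretive_apply_le_of_reg)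

/-! ## §1 Constraint straightening is a congruence of the bordered letters [folklore; gan24-idea-1 g45, any field] -/

section Congr

variable {𝕜 : Type*} [Field 𝕜]
variable {ν μ : Type*} [Fintype ν] [Fintype μ] [DecidableEq ν] [DecidableEq μ]
variable {H : Matrix ν ν 𝕜} {Q : Matrix μ ν 𝕜} {V W : Matrix ν ν 𝕜}

omit [DecidableEq ν] in
/-- **congruence of the bordered matrix** under a change of fine variables `u = Vu′`. [folklore; gan24-idea-1 g45] -/
theorem kkt_congr (H : Matrix ν ν 𝕜) (Q : Matrix μ ν 𝕜) (V : Matrix ν ν 𝕜) :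
    kkt (Vᵀ * H * V) (Q * V) = fromBlocks Vᵀ 0 0 (1 : Matrix μ μ 𝕜) * kkt H Q * fromBlocks V 0 0 (1 : Matrix μ μ 𝕜) := by
  rw [kkt_eq_fromBlocks, kkt_eq_fromBlocks, fromBlocks_multiply, fromBlocks_multiply]
  simp [Matrix.transpose_mul, Matrix.mul_assoc]

/-- [folklore] `det kkt(VᵀHV, QV) = (det V)²·det kkt(H,Q)`. -/
theorem det_kkt_congr (H : Matrix ν ν 𝕜) (Q : Matrix μ ν 𝕜) (V : Matrix ν ν 𝕜) :
    (kkt (Vᵀ * H * V) (Q * V)).det = V.det ^ 2 * (kkt H Q).det := by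
  rw [kkt_congr, det_mul, det_mul, det_fromBlocks_zero₂₁, det_fromBlocks_zero₂₁, det_transpose, det_one]
  ring

/-- [folklore] for invertible `V`, `kkt(VᵀHV, QV)` is nonsingular iff `kkt(H,Q)` is. -/
theorem isUnit_det_kkt_congr_iff (hV : IsUnit V.det) : IsUnit (kkt (Vᵀ * H * V) (Q * V)).det ↔ IsUnit (kkt H Q).det := by
  rw [det_kkt_congr, IsUnit.mul_iff]
  exact ⟨fun h => h.2, fun h => ⟨hV.pow 2, h⟩⟩

/-- [folklore; gan24-idea-1 g45] **congruence of the bordered inverse**. -/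
theorem kktInv_congr (hV : IsUnit V.det) (h : IsUnit (kkt H Q).det) :
    (kkt (Vᵀ * H * V) (Q * V))⁻¹ = fromBlocks V⁻¹ 0 0 (1 : Matrix μ μ 𝕜) * (kkt H Q)⁻¹ * fromBlocks Vᵀ⁻¹ 0 0 (1 : Matrix μ μ 𝕜) := by
  have hVt : IsUnit Vᵀ.det := by rwa [det_transpose]
  have h1 : fromBlocks Vᵀ⁻¹ 0 0 (1 : Matrix μ μ 𝕜) * fromBlocks Vᵀ 0 0 (1 : Matrix μ μ 𝕜) = 1 := by
    rw [fromBlocks_multiply, nonsing_inv_mul _ hVt]; simp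
  have h3 : fromBlocks V⁻¹ 0 0 (1 : Matrix μ μ 𝕜) * fromBlocks V 0 0 (1 : Matrix μ μ 𝕜) = 1 := by
    rw [fromBlocks_multiply, nonsing_inv_mul _ hV]; simp
  apply inv_eq_left_inv
  rw [kkt_congr]
  calc fromBlocks V⁻¹ 0 0 (1 : Matrix μ μ 𝕜) * (kkt H Q)⁻¹ * fromBlocks Vᵀ⁻¹ 0 0 (1 : Matrix μ μ 𝕜) *
        (fromBlocks Vᵀ 0 0 (1 : Matrix μ μ 𝕜) * kkt H Q * fromBlocks V 0 0 (1 : Matrix μ μ 𝕜))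
      = fromBlocks V⁻¹ 0 0 (1 : Matrix μ μ 𝕜) *
          ((kkt H Q)⁻¹ * ((fromBlocks Vᵀ⁻¹ 0 0 (1 : Matrix μ μ 𝕜) * fromBlocks Vᵀ 0 0 (1 : Matrix μ μ 𝕜)) * kkt H Q)) *
          fromBlocks V 0 0 (1 : Matrix μ μ 𝕜) := by
        simp only [Matrix.mul_assoc]
    _ = fromBlocks V⁻¹ 0 0 (1 : Matrix μ μ 𝕜) * fromBlocks V 0 0 (1 : Matrix μ μ 𝕜) := by
        rw [h1, Matrix.one_mul, nonsing_inv_mul _ h, Matrix.mul_one]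
    _ = 1 := h3

/-- **`effForm_congr` — THE EFFECTIVE FORM IS CONGRUENCE-INVARIANT**: `𝒮(VᵀHV, QV) = 𝒮(H,Q)` — the constrained value does not see a change of fine
variables. [folklore; gan24-idea-1 g45] -/
theorem effForm_congr (hV : IsUnit V.det) (h : IsUnit (kkt H Q).det) : effForm (Vᵀ * H * V) (Q * V) = effForm H Q := by
  rw [effForm, kktInv_congr hV h, kktInv_eq_fromBlocks H Q, fromBlocks_multiply, fromBlocks_multiply]
  simp

/-- [folklore; gan24-idea-1 g45] the minimiser transforms as a fine field: `ℋ(VᵀHV, QV) = V⁻¹ℋ(H,Q)`. -/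
theorem minOp_congr (hV : IsUnit V.det) (h : IsUnit (kkt H Q).det) : minOp (Vᵀ * H * V) (Q * V) = V⁻¹ * minOp H Q := by
  rw [minOp, kktInv_congr hV h, kktInv_eq_fromBlocks H Q, fromBlocks_multiply, fromBlocks_multiply]
  simp

/-- [folklore; gan24-idea-1 g45] **straightening factorisation**: a right inverse `R` of `Q` factors a two-jet constraint family through `Q`:
`Q + z₁Q₁ + z₂Q₂ = Q·(1 + z₁RQ₁ + z₂RQ₂)`. -/
theorem straighten₂_of_rightInverse (R : Matrix ν μ 𝕜) (hR : Q * R = 1) (Q₁ Q₂ : Matrix μ ν 𝕜) (z₁ z₂ : 𝕜) :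
    Q + z₁ • Q₁ + z₂ • Q₂ = Q * (1 + z₁ • (R * Q₁) + z₂ • (R * Q₂)) := by
  rw [Matrix.mul_add, Matrix.mul_add, Matrix.mul_one, Matrix.mul_smul, Matrix.mul_smul, ← Matrix.mul_assoc Q R Q₁, ← Matrix.mul_assoc Q R Q₂, hR,
    Matrix.one_mul, Matrix.one_mul]

/-- **`straighten₂_by_minOp`** [folklore; gan24-idea-1 g45]: the minimiser of ANY nonsingular datum `(H₀, Q)` is such a right inverse (`Qℋ = 1`, an2's
`mul_minOp`): `Q + z₁Q₁ + z₂Q₂ = Q·(1 + z₁ℋQ₁ + z₂ℋQ₂)`, `ℋ = ℋ(H₀,Q)`. -/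
theorem straighten₂_by_minOp {H₀ : Matrix ν ν 𝕜} (h : IsUnit (kkt H₀ Q).det) (Q₁ Q₂ : Matrix μ ν 𝕜) (z₁ z₂ : 𝕜) :
    Q + z₁ • Q₁ + z₂ • Q₂ = Q * (1 + z₁ • (minOp H₀ Q * Q₁) + z₂ • (minOp H₀ Q * Q₂)) :=
  straighten₂_of_rightInverse (minOp H₀ Q) (mul_minOp H₀ Q h) Q₁ Q₂ z₁ z₂

/-- **`effForm_straighten` — THE STRAIGHTENED DATUM** [folklore; gan24-idea-1 g45]: for an invertible straightening factor `W`, `𝒮(H, Q·W) = 𝒮(W⁻ᵀHW⁻¹, Q)`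
— the constraint map is jet-free again, all jets sit in the fine form. -/
theorem effForm_straighten (hW : IsUnit W.det) (h : IsUnit (kkt H (Q * W)).det) : effForm H (Q * W) = effForm (W⁻¹ᵀ * H * W⁻¹) Q := by
  have hW' : IsUnit W⁻¹.det := isUnit_nonsing_inv_det_iff.mpr hW
  have key := effForm_congr (H := H) (Q := Q * W) hW' h
  rw [Matrix.mul_assoc Q W W⁻¹, mul_nonsing_inv _ hW, Matrix.mul_one] at key
  exact key.symm

/-- **`isUnit_det_kkt_straighten_iff`** [folklore]: for invertible `W`, `kkt(H, Q·W)` is nonsingular IFF `kkt(W⁻ᵀHW⁻¹, Q)` is. -/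
theorem isUnit_det_kkt_straighten_iff (hW : IsUnit W.det) : IsUnit (kkt H (Q * W)).det ↔ IsUnit (kkt (W⁻¹ᵀ * H * W⁻¹) Q).det := by
  have hW' : IsUnit W⁻¹.det := isUnit_nonsing_inv_det_iff.mpr hW
  have key := isUnit_det_kkt_congr_iff (H := H) (Q := Q * W) hW'
  rw [Matrix.mul_assoc Q W W⁻¹, mul_nonsing_inv _ hW, Matrix.mul_one] at key
  exact key.symm

end Congr

/-! ## §2 Every complex fine form is an accretive datum: `M = (Re M)^ + i•(Im M)^` -/

section Split

variable {ν μ : Type*} [Fintype ν] [Fintype μ] [DecidableEq ν] [DecidableEq μ]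

omit [Fintype ν] [DecidableEq ν] in
/-- [folklore] the real∕imaginary split of a complex matrix in the letters of PART 35. -/
theorem eq_map_re_add_map_im {m : Type*} (M : Matrix m ν ℂ) :
    M = (M.map Complex.re).map (Complex.ofRealHom : ℝ →+* ℂ) + Complex.I • (M.map Complex.im).map (Complex.ofRealHom : ℝ →+* ℂ) := by
  ext i j
  simp only [Matrix.add_apply, Matrix.smul_apply, Matrix.map_apply, Complex.ofRealHom_eq_coe, smul_eq_mul]
  rw [mul_comm]
  exact (Complex.re_add_im (M i j)).symm

omit [Fintype ν] [DecidableEq ν] in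
/-- [folklore] the real part of a complex-symmetric matrix is symmetric. -/
theorem transpose_map_re {M : Matrix ν ν ℂ} (hM : Mᵀ = M) : (M.map Complex.re)ᵀ = M.map Complex.re := by
  rw [← Matrix.transpose_map, hM]

omit [Fintype ν] [DecidableEq ν] in
/-- [folklore] the imaginary part of a complex-symmetric matrix is symmetric. -/
theorem transpose_map_im {M : Matrix ν ν ℂ} (hM : Mᵀ = M) : (M.map Complex.im)ᵀ = M.map Complex.im := by
  rw [← Matrix.transpose_map, hM]

variable {M : Matrix ν ν ℂ} {Q : Matrix μ ν ℝ} {κ Λ a₀ : ℝ}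

/-- **`isUnit_det_kkt_of_re_im` — PART 35 (D) FOR A GENERAL COMPLEX-SYMMETRIC FINE FORM** [our proof]: `M` complex symmetric with `Re M` PSD and
`kkt(Re M, Q)` nonsingular (real constraint map) ⟹ `kkt(M, Q̂)` nonsingular. -/
theorem isUnit_det_kkt_of_re_im (hM : Mᵀ = M) (hre : (M.map Complex.re).PosSemidef) (h : IsUnit (kkt (M.map Complex.re) Q).det) :
    IsUnit (kkt M (Q.map (Complex.ofRealHom : ℝ →+* ℂ))).det := by
  have key := isUnit_det_kkt_accretive hre (transpose_map_im hM) h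
  rwa [← eq_map_re_add_map_im M] at key

/-- **`norm_effForm_apply_le_of_re_im` — PART 36 (A′) FOR A GENERAL COMPLEX-SYMMETRIC FINE FORM** [our proof]: `M` complex symmetric, `Re M` PSD with
`kkt(Re M, Q)` nonsingular, the sector letter `±Im M ≤ κ·(Re M + a₀QᵀQ)` (`0 ≤ κ`, `0 ≤ a₀`) and the row bound `⟨w, 𝒮(Re M, Q)w⟩ ≤ Λ|w|²` ⟹
`‖𝒮(M, Q̂)(x,y)‖ ≤ (1 + κ√(2+κ²))·(Λ + a₀) + a₀`. -/
theorem norm_effForm_apply_le_of_re_im (hM : Mᵀ = M) (hre : (M.map Complex.re).PosSemidef) (h : IsUnit (kkt (M.map Complex.re) Q).det)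
    (hκ : 0 ≤ κ) (ha : 0 ≤ a₀)
    (hKm : (κ • (M.map Complex.re + Qᵀ * (a₀ • (1 : Matrix μ μ ℝ)) * Q) - M.map Complex.im).PosSemidef)
    (hKp : (κ • (M.map Complex.re + Qᵀ * (a₀ • (1 : Matrix μ μ ℝ)) * Q) + M.map Complex.im).PosSemidef)
    (hΛ : ∀ w : μ → ℝ, w ⬝ᵥ (effForm (M.map Complex.re) Q *ᵥ w) ≤ Λ * (w ⬝ᵥ w)) (x y : μ) :
    ‖effForm M (Q.map (Complex.ofRealHom : ℝ →+* ℂ)) x y‖ ≤ (1 + κ * Real.sqrt (2 + κ ^ 2)) * (Λ + a₀) + a₀ := by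
  have key := norm_effForm_accretive_apply_le_of_reg ha hre (transpose_map_im hM) h hκ hKm hKp hΛ x y
  rwa [← eq_map_re_add_map_im M] at key

end Split

/-! ## §3 S2 with constraint jets at one point: the straightening factor + the accretive letters of the straightened form -/

section Jets

variable {ν μ : Type*} [Fintype ν] [Fintype μ] [DecidableEq ν] [DecidableEq μ]
variable {Hz : Matrix ν ν ℂ} {Q : Matrix μ ν ℝ} {W : Matrix ν ν ℂ} {κ Λ a₀ : ℝ}

/-- **`isUnit_det_kkt_jets_of_straighten`** [our proof]: at a point where the jetted constraint map is `Q̂·W` with `W` invertible, and the straightened fine form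
`M_W := W⁻ᵀ·Hz·W⁻¹` is complex symmetric with `Re M_W` PSD and `kkt(Re M_W, Q)` nonsingular, the bordered matrix `kkt(Hz, Q̂·W)` is nonsingular. -/
theorem isUnit_det_kkt_jets_of_straighten (hW : IsUnit W.det) (hsym : (W⁻¹ᵀ * Hz * W⁻¹)ᵀ = W⁻¹ᵀ * Hz * W⁻¹)
    (hre : ((W⁻¹ᵀ * Hz * W⁻¹).map Complex.re).PosSemidef) (h : IsUnit (kkt ((W⁻¹ᵀ * Hz * W⁻¹).map Complex.re) Q).det) :
    IsUnit (kkt Hz (Q.map (Complex.ofRealHom : ℝ →+* ℂ) * W)).det :=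
  (isUnit_det_kkt_straighten_iff hW).mpr (isUnit_det_kkt_of_re_im hsym hre h)

/-- **`norm_effForm_jets_le_of_straighten`** [our proof]: under the same structure plus the sector letter `±Im M_W ≤ κ·(Re M_W + a₀QᵀQ)` and the row bound
`Λ` of `𝒮(Re M_W, Q)`: `‖𝒮(Hz, Q̂·W)(x,y)‖ ≤ (1 + κ√(2+κ²))·(Λ + a₀) + a₀` — S2's `hB` for a family WITH constraint jets, at one point, from the accretive
real letters of the straightened form. -/
theorem norm_effForm_jets_le_of_straighten (hW : IsUnit W.det) (hsym : (W⁻¹ᵀ * Hz * W⁻¹)ᵀ = W⁻¹ᵀ * Hz * W⁻¹)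
    (hre : ((W⁻¹ᵀ * Hz * W⁻¹).map Complex.re).PosSemidef) (h : IsUnit (kkt ((W⁻¹ᵀ * Hz * W⁻¹).map Complex.re) Q).det)
    (hκ : 0 ≤ κ) (ha : 0 ≤ a₀)
    (hKm : (κ • ((W⁻¹ᵀ * Hz * W⁻¹).map Complex.re + Qᵀ * (a₀ • (1 : Matrix μ μ ℝ)) * Q) - (W⁻¹ᵀ * Hz * W⁻¹).map Complex.im).PosSemidef)
    (hKp : (κ • ((W⁻¹ᵀ * Hz * W⁻¹).map Complex.re + Qᵀ * (a₀ • (1 : Matrix μ μ ℝ)) * Q) + (W⁻¹ᵀ * Hz * W⁻¹).map Complex.im).PosSemidef)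
    (hΛ : ∀ w : μ → ℝ, w ⬝ᵥ (effForm ((W⁻¹ᵀ * Hz * W⁻¹).map Complex.re) Q *ᵥ w) ≤ Λ * (w ⬝ᵥ w)) (x y : μ) :
    ‖effForm Hz (Q.map (Complex.ofRealHom : ℝ →+* ℂ) * W) x y‖ ≤ (1 + κ * Real.sqrt (2 + κ ^ 2)) * (Λ + a₀) + a₀ := by
  rw [effForm_straighten hW (isUnit_det_kkt_jets_of_straighten hW hsym hre h)]
  exact norm_effForm_apply_le_of_re_im hsym hre h hκ ha hKm hKp hΛ x y

/-- **`symm_straighten`** [folklore]: the straightened form of a complex-symmetric `Hz` is complex symmetric. -/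
theorem symm_straighten (hHz : Hzᵀ = Hz) : (W⁻¹ᵀ * Hz * W⁻¹)ᵀ = W⁻¹ᵀ * Hz * W⁻¹ := by
  rw [Matrix.transpose_mul, Matrix.transpose_mul, Matrix.transpose_transpose, hHz, Matrix.mul_assoc]

end Jets

end Summit.QuantumFields.BalabanUV.Beta.GAN24.DerivativeRateTransferStraighten

end
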